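import Literature.AnabelianGeometry.EtaleTheta.Discharge.Sec2AutKDotted
import Mathlib.GroupTheory.Commensurable
import HarnessLib

/-!
# [EtTh] Corollary 2.9: the cusp-stabiliser hypotheses `hC1`/`hC2` REDUCED to the tempered decomposition
# group of the cusp of `C` (proof-only; GAP-LEDGER G-L2d3-2)

S. Mochizuki, *The étale theta function and its Frobenioid-theoretic manifestations*, Publ. RIMS **45** (2009)
[MochizukiEtTh2009], §2, Def. 2.1 p.262 (PDF p.36) ("the restricted map `D_x → Q` is trivial … `ι` …
multiplication by `−1` … relative to choosing the unique cusp of `X` as origin") and Cor. 2.9 p.269 (PDF p.43);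
S. Mochizuki, *Semi-graphs of anabelioids* [MochizukiSemiAnbd2006] §6 p.71 ("`x` determines, up to conjugation
…, a decomposition group `D_x`") and the commensurable terminality of cuspidal decomposition groups
([AbsAnab] Lemma 1.3.7, MochizukiAbsAnab2004, p.18 — the tree's named fact
`CuspidalData.InertiaCommensurablyTerminal`, FACT-LIST F-0003).

abc-iut cell, layer L2, L2-lead ROWS #13-addendum (R105) → seat abc-iut-w5-d118: GAP-LEDGER row **G-L2d3-2**.
The discharge files of abc-iut-L2-d3 for [EtTh] Cor. 2.9 (`Discharge/Sec2CuspOrbits.lean`,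
`Discharge/Sec2AutKHolds.lean`, `Discharge/Sec2AutKDotted.lean`) prove the cardinality statement
`#(Aut_K(−)-orbits of cusps) = #(ℤ/lℤ)^± = (l+1)/2` MODULO two hypotheses on the stabiliser
`cuspStabC := N_{Π^tp_C}(tp D_x)` of the cusp of `C`:

  `hC1 : T.cuspStabC ⊓ T.tp T.PiX ≤ T.tp T.PiXu`,   `hC2 : ¬ T.cuspStabC ≤ T.tp T.PiX`,

which the interface `ThetaCovers.TemperedCoverData` (abc-iut-L2-t2) cannot supply: it relates the cusp
`x` to the PROFINITE `Π_X` only (field `Dx ≤ PiX`), so that a model with `tp D_x = 1` satisfies every field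
and refutes the count (finding of abc-iut-L2-d3, recorded as G-L2d3-2: "MISSING INTERFACE FIELD").  The row's
proposed disposition names the printed inputs: "the tempered decomposition group of the cusp of `C` (contains
`tp D_x` with index 2, meets `Π^tp_C ∖ Π^tp_X`, self-normalising)".

This file REDUCES `hC1`, `hC2` — and hence Cor. 2.9 — to exactly those inputs, typed as NAMED BINDERS on an
arbitrary `T : TemperedCoverData l` (no field added, no new `Prop` constant): a subgroup
`DC ⊆ Π^tp_C` (the tempered decomposition group `D^tp_{x_C}` of the cusp of `C`) with

* (B1) `hDCX : DC ⊓ T.tp T.PiX = T.tp T.Dx` — its trace on `Π^tp_X` is the tempered decomposition group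
  `tp D_x` of the cusp of `X` over it ([SemiAnbd] §6 p.71; index `≤ 2` since `[Π^tp_C : Π^tp_X] ≤ 2`);
* (B2) `hι : ¬ DC ≤ T.tp T.PiX` — it contains an element of `Π^tp_C ∖ Π^tp_X`: the inversion `ι` of
  `C = X/{±1}` fixes the origin = the cusp of `X` ([EtTh] Def. 2.1 p.36);
* (B3) `hct : commensurator DC ≤ DC` — COMMENSURABLE TERMINALITY of the cuspidal decomposition group in
  `Π^tp_C` ([AbsAnab] Lem. 1.3.7 / [SemiAnbd] §6; Mathlib `Subgroup.Commensurable.commensurator`).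

PROVED (all `theorem`s): `cuspStabC_eq_of_cuspDecomp : T.cuspStabC = DC` (`N(tp D_x) ⊆ Comm(tp D_x) =
Comm(DC) ⊆ DC` by Mathlib's `Subgroup.Commensurable.eq`, `tp D_x` being of finite index in `DC`; and
`DC ⊆ N(tp D_x)` since `tp Π_X ⊴ Π^tp_C`), whence **`hC1_of_cuspDecomp`**, **`hC2_of_cuspDecomp`**, and the
consumers with `hC1`/`hC2` DISCHARGED: `natCard_cuspOrbits_tpPiCu_of_cuspDecomp`,
`natCard_cuspOrbits_tpPiCuu_of_cuspDecomp`, `cor29_card_undotted_of_cuspDecomp` (members `X̲̲, C̲, C̲̲`, modulo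
`hΘ`), `cor29_card_of_cuspDecomp` (all six members: abc-iut-L2-d3's `cor29_card_of`, modulo `hslim`, `h26`, `hΘ`).
G-L2d3-2 thereby reads «REDUCED to the `D^tp_{x_C}` data (B1)–(B3)»; the data themselves are interface items
for the post-13:00Z window (owner abc-iut-L2-t2 lineage) or theorems at a genuine model (abc-iut-L2-t10 P2).

HONEST FRAMING: kernel-checked implications between typed statements about the [EtTh] §2 interface; nothing
asserts that a `TemperedCoverData` exists for an actual curve; refereed [EtTh]/[SemiAnbd]/[AbsAnab] material;
no side taken on [IUTchIII] Cor. 3.12; typed ≠ proved for the named binders.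
-/

namespace Literature.AnabelianGeometry.EtaleTheta

namespace ThetaCovers

open Literature.AlgebraicGeometry.Frobenioids (IsSlimGroup)
open Subgroup.Commensurable (commensurator)
open scoped Pointwise

universe u

/-! ### Group theory: normalisers of finite-index subgroups of a commensurably terminal subgroup -/

section GroupTheory

variable {G : Type*} [Group G]

/-- The normaliser of a subgroup is contained in its commensurator (`gHg⁻¹ = H` is commensurable with `H`).
[cite: MochizukiAbsAnab2004, Lem 1.3.7 p.18] -/
theorem normalizer_le_commensurator (H : Subgroup G) :
    Subgroup.normalizer (H : Set G) ≤ commensurator H := by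
  intro g hg
  rw [Subgroup.Commensurable.commensurator_mem_iff]
  have hgH : ConjAct.toConjAct g • H = H := by
    ext x
    rw [Subgroup.mem_pointwise_smul_iff_inv_smul_mem, ← map_inv, ConjAct.toConjAct_smul, inv_inv,
      Subgroup.mem_normalizer_iff.mp hg (g⁻¹ * x * g)]
    simp [mul_assoc]
  rw [hgH]

/-- If `D` is COMMENSURABLY TERMINAL (`Comm(D) ⊆ D`) then the normaliser of any subgroup `H ⊆ D` of finite
index in `D` is contained in `D`: `N(H) ⊆ Comm(H) = Comm(D) ⊆ D`. [cite: MochizukiAbsAnab2004, Lem 1.3.7 p.18] -/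
theorem normalizer_le_of_commensurator_le {D H : Subgroup G} (hHD : H ≤ D) (hidx : H.relIndex D ≠ 0)
    (hct : commensurator D ≤ D) : Subgroup.normalizer (H : Set G) ≤ D := by
  have hcomm : Subgroup.Commensurable H D :=
    ⟨hidx, by rw [Subgroup.relIndex_eq_one.mpr hHD]; exact one_ne_zero⟩
  calc Subgroup.normalizer (H : Set G) ≤ commensurator H := normalizer_le_commensurator H
    _ = commensurator D := Subgroup.Commensurable.eq hcomm
    _ ≤ D := hct

/-- For a NORMAL subgroup `N` and any subgroup `D`, `D` normalises `D ⊓ N` (the step «`D^tp_{x_C}`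
normalises its trace `tp D_x` on the normal subgroup `Π^tp_X`»). [cite: MochizukiEtTh2009, Cor 2.9 p.43] -/
theorem le_normalizer_inf_of_normal (D N : Subgroup G) [N.Normal] :
    D ≤ Subgroup.normalizer ((D ⊓ N : Subgroup G) : Set G) := by
  intro d hd
  rw [Subgroup.mem_normalizer_iff]
  intro x
  constructor
  · rintro ⟨hxD, hxN⟩
    exact ⟨D.mul_mem (D.mul_mem hd hxD) (D.inv_mem hd), ‹N.Normal›.conj_mem x hxN d⟩
  · rintro ⟨hxD, hxN⟩
    refine ⟨?_, ?_⟩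
    · have := D.mul_mem (D.mul_mem (D.inv_mem hd) hxD) hd
      simpa [mul_assoc] using this
    · have := ‹N.Normal›.conj_mem _ hxN d⁻¹
      simpa [mul_assoc] using this

end GroupTheory

/-! ### The reduction for `TemperedCoverData` -/

namespace TemperedCoverData

variable {l : ℕ} (T : TemperedCoverData.{u} l)

/-- `tp Π_X = Π^tp_X` is normal in `Π^tp_C` (inverse image of the normal `Π_X ⊴ Π_C`).
[cite: MochizukiEtTh2009, Def 2.1 p.36] -/
theorem tp_PiX_normal : (T.tp T.PiX).Normal := by
  haveI := T.PiX_normal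
  exact Subgroup.Normal.comap inferInstance _

/-- `Π^tp_X` has finite index in `Π^tp_C` (it divides `[Π_C : Π_X] = 2`). [cite: MochizukiEtTh2009, Def 2.1 p.36] -/
theorem index_tp_PiX_ne_zero : (T.tp T.PiX).index ≠ 0 := by
  haveI := T.PiX_normal
  intro h0
  have hdvd : T.PiX.relIndex T.toHat.range ∣ T.PiX.index := Subgroup.relIndex_dvd_index_of_normal _ _
  rw [← Subgroup.index_comap, show T.PiX.comap T.toHat = T.tp T.PiX from rfl, h0, T.index_PiX] at hdvd
  exact absurd (Nat.eq_zero_of_zero_dvd hdvd) two_ne_zero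

variable {T}
variable {DC : Subgroup T.Gtp}

/-- **`cuspStabC = D^tp_{x_C}`**: under (B1) `DC ⊓ Π^tp_X = tp D_x` and (B3) commensurable terminality of
`DC`, the stabiliser `N_{Π^tp_C}(tp D_x)` of abc-iut-L2-t2's `cuspStabC` IS the tempered decomposition group of
the cusp of `C`: `DC ⊆ N(tp D_x)` because `tp D_x = DC ∩ Π^tp_X` with `Π^tp_X ⊴ Π^tp_C`, and
`N(tp D_x) ⊆ Comm(tp D_x) = Comm(DC) ⊆ DC` because `[DC : tp D_x] ≤ [Π^tp_C : Π^tp_X] < ∞`.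
[cite: MochizukiEtTh2009, Cor 2.9 p.43] -/
theorem cuspStabC_eq_of_cuspDecomp (hDCX : DC ⊓ T.tp T.PiX = T.tp T.Dx) (hct : commensurator DC ≤ DC) :
    T.cuspStabC = DC := by
  haveI := T.tp_PiX_normal
  refine le_antisymm ?_ ?_
  · change Subgroup.normalizer ((T.tp T.Dx : Subgroup T.Gtp) : Set T.Gtp) ≤ DC
    rw [← hDCX]
    refine normalizer_le_of_commensurator_le inf_le_left ?_ hct
    rw [Subgroup.inf_relIndex_left]
    intro h0
    have hdvd := Subgroup.relIndex_dvd_index_of_normal (T.tp T.PiX) DC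
    rw [h0] at hdvd
    exact T.index_tp_PiX_ne_zero (Nat.eq_zero_of_zero_dvd hdvd)
  · change DC ≤ Subgroup.normalizer ((T.tp T.Dx : Subgroup T.Gtp) : Set T.Gtp)
    rw [← hDCX]
    exact le_normalizer_inf_of_normal DC (T.tp T.PiX)

/-- **`hC1` REDUCED**: under (B1) and (B3) the stabiliser in `Π^tp_X` of the cusp lies in `Π^tp_{X̲}` — indeed
it IS `tp D_x`, and `D_x ⊆ Π_{X̲}` ("the restricted map `D_x → Q` is trivial", Def. 2.1; abc-iut-L2-d3's
`cuspStabC_inf_le_of_selfNormalizing`). [cite: MochizukiEtTh2009, Def 2.1 p.36] -/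
theorem hC1_of_cuspDecomp (hDCX : DC ⊓ T.tp T.PiX = T.tp T.Dx) (hct : commensurator DC ≤ DC) :
    T.cuspStabC ⊓ T.tp T.PiX ≤ T.tp T.PiXu :=
  T.cuspStabC_inf_le_of_selfNormalizing (by rw [cuspStabC_eq_of_cuspDecomp hDCX hct, hDCX])

/-- **`hC2` REDUCED**: under (B1), (B3) and (B2) `DC ⊄ Π^tp_X` (the inversion of `C = X/{±1}` fixes the cusp
of `X`), the cusp stabiliser is not contained in `Π^tp_X`. [cite: MochizukiEtTh2009, Def 2.1 p.36] -/
theorem hC2_of_cuspDecomp (hDCX : DC ⊓ T.tp T.PiX = T.tp T.Dx) (hι : ¬ DC ≤ T.tp T.PiX)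
    (hct : commensurator DC ≤ DC) : ¬ T.cuspStabC ≤ T.tp T.PiX := by
  rwa [cuspStabC_eq_of_cuspDecomp hDCX hct]

/-- **Cor. 2.9 for `C̲`** with the cusp hypotheses DISCHARGED from the `D^tp_{x_C}` data (B1)–(B3):
`#(Aut_K(C̲)-orbits of cusps) = (l+1)/2` (abc-iut-L2-d3's `natCard_cuspOrbits_tpPiCu`).
[cite: MochizukiEtTh2009, Cor 2.9 p.43] -/
theorem natCard_cuspOrbits_tpPiCu_of_cuspDecomp (hDCX : DC ⊓ T.tp T.PiX = T.tp T.Dx) (hι : ¬ DC ≤ T.tp T.PiX)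
    (hct : commensurator DC ≤ DC) : Nat.card (T.cuspOrbits (T.tp T.PiCu)) = (l + 1) / 2 :=
  T.natCard_cuspOrbits_tpPiCu (hC1_of_cuspDecomp hDCX hct) (hC2_of_cuspDecomp hDCX hι hct)

/-- **Cor. 2.9 for `C̲̲`** (under `HasMuL`: `K ⊇ μ_l`) with the cusp hypotheses DISCHARGED from (B1)–(B3)
(abc-iut-L2-d3's `natCard_cuspOrbits_tpPiCuu`). [cite: MochizukiEtTh2009, Cor 2.9 p.43] -/
theorem natCard_cuspOrbits_tpPiCuu_of_cuspDecomp (hmu : T.HasMuL) (hDCX : DC ⊓ T.tp T.PiX = T.tp T.Dx)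
    (hι : ¬ DC ≤ T.tp T.PiX) (hct : commensurator DC ≤ DC) :
    Nat.card (T.cuspOrbits (T.tp T.PiCuu)) = (l + 1) / 2 :=
  T.natCard_cuspOrbits_tpPiCuu hmu (hC1_of_cuspDecomp hDCX hct) (hC2_of_cuspDecomp hDCX hι hct)

/-- **Cor. 2.9, undotted members `X̲̲, C̲, C̲̲`** with the cusp hypotheses DISCHARGED from (B1)–(B3), modulo the
printed definition of `Δ̄_Θ` (`hΘ`) (abc-iut-L2-d3's `cor29_card_undotted_of`).
[cite: MochizukiEtTh2009, Cor 2.9 p.43] -/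
theorem cor29_card_undotted_of_cuspDecomp (hΘ : ⁅T.DeltaX, T.DeltaX⁆ ⊔ T.barKer = T.barTheta)
    (hDCX : DC ⊓ T.tp T.PiX = T.tp T.Dx) (hι : ¬ DC ≤ T.tp T.PiX) (hct : commensurator DC ≤ DC) :
    T.HasMuL → ∀ S ∈ [T.tp T.PiXuu, T.tp T.PiCu, T.tp T.PiCuu],
      Nat.card (T.cuspOrbits S) = (l + 1) / 2 :=
  T.cor29_card_undotted_of hΘ (hC1_of_cuspDecomp hDCX hct) (hC2_of_cuspDecomp hDCX hι hct)

/-- **[EtTh] Corollary 2.9 (all six members, the typed statement `Cor29_card`)** with the cusp hypotheses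
DISCHARGED from the `D^tp_{x_C}` data (B1)–(B3), modulo temp-slimness of `Π^tp_C`, Prop. 2.6 and the
printed definition of `Δ̄_Θ` (abc-iut-L2-d3's `cor29_card_of`). [cite: MochizukiEtTh2009, Cor 2.9 p.43] -/
theorem cor29_card_of_cuspDecomp (hslim : IsSlimGroup T.Gtp) (h26 : T.Prop26)
    (hΘ : ⁅T.DeltaX, T.DeltaX⁆ ⊔ T.barKer = T.barTheta) (hDCX : DC ⊓ T.tp T.PiX = T.tp T.Dx)
    (hι : ¬ DC ≤ T.tp T.PiX) (hct : commensurator DC ≤ DC) : T.Cor29_card :=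
  T.cor29_card_of hslim h26 hΘ (hC1_of_cuspDecomp hDCX hct) (hC2_of_cuspDecomp hDCX hι hct)

end TemperedCoverData

end ThetaCovers

end Literature.AnabelianGeometry.EtaleTheta
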